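import Summits.ABC.IUTFork.Joshi.AnsatzStandardPoint
import Mathlib.Algebra.Order.AbsoluteValue.Basic
import Mathlib.Analysis.SpecialFunctions.Log.Basic
import Mathlib.Analysis.SpecialFunctions.Pow.Real
import Mathlib.LinearAlgebra.Finsupp.LinearCombination
import Mathlib.Order.Filter.Cofinite
import Mathlib.Algebra.Group.Subgroup.Basic
import HarnessLib

/-!
# Joshi, ATS III §4.6: the global arithmetic PERIOD MAPPING on Mochizuki's Adelic Ansatz (Thm. 4.6.1, Rmk. 4.6.2)
# (block E «type Joshi's construction», slot T-08, OBJECTS.tsv O-020; file 2 of 3, sequel to `AnsatzStandardPoint`)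

Record-only typing (D-0012) of K. Joshi, *Construction of Arithmetic Teichmüller Spaces III*,
arXiv:2401.13508v4 («[J-III]»; unrefereed, "Preliminary version for comments"), §4.6, PDF pp. 36–38
(render `HOME/lit/renders/Joshi-arxiv-2401.13508/p00NN.txt`; «p.N l.M» = line M of PDF page N), with the
upstream notions of *ATS II½*, arXiv:2305.10398 («[J-IIh]» = "[Joshi, 2023a]" of [J-III]; render
`HOME/plan/repair/lit/renders/Joshi-arxiv-2305.10398-ATS2half/`) that Thm. 4.6.1 quotes and whose proof it cites
("This is clear from [J-IIh] Theorem 5.10.1", p.37 l.44–45): arithmeticoids ([J-IIh] Def. 5.1.1), normalization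
coordinates ([J-IIh] §5.3), ideloids and the arithmetic degree ([J-IIh] Def. 5.4.1–5.4.4), the product formula
as a period mapping ([J-IIh] Thm. 5.10.1). TAKES NO SIDE on [IUTchIII] Cor. 3.12, on Joshi's claims, or on any
author; typed ≠ proved; typed AS A CANDIDATE ≠ endorsed; every statement print ASSERTS is a `def … : Prop`
tagged `@[claim "Joshi2024ATS3" "disputed"]` ("disputed" records that a dispute exists in print and takes no
side), never an axiom / `sorry` / Literature fact; a property that FOLLOWS from the typed signature is a proved
`theorem` (kernel glue, `[folklore]`).

## Contents (one declaration per printed item)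
* `ArithPeriodDatum L` — adds to `AnsatzCurveDatum`, per place `w` and point `y_w`, the residue field `K_{y_w}`
  with `|−|_{K_{y_w}}` and `L′ ↪ K_{y_w}` ([J-IIh] Def. 5.1.1), the normalization coordinates `α_y` ([J-IIh]
  (5.3.5)) and the standard absolute values `|−|_w` ([J-IIh] (5.3.3)). merge-debt: J2h §5 = slot T-37
  (`Joshi/Arithmeticoids.lean`); J3 §4.1–4.2 = slot T-07's LANDED `Joshi.AdelicCurveDatum` (`Joshi/AdelicAnsatz.lean`),
  field map for the batch-3 reconciliation: `V ↦ V`, `Voddss ↦ oddss`, `Y ↦ Y`, `lstar ↦ lstar`, `ansatz ↦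
  adelicAnsatz`, `first ↦ jOne`, `last ↦ jLast`, `jOf ↦ printedIndex`; T-07 reads the residue valuations on a common
  evaluation domain `T p_w` (`absK`), this file reads them on `L′` through `emb` — the sequel's `ScalingOnL` /
  `DiagonalOnL` are T-07's `ValuationScaling` / `ValuationConstantOffSS` restricted to the image of `L′`.
* Thm. 4.6.1 (1)–(7) (= [J-IIh] Thm. 5.10.1 (1)–(8)): `ideloid`, `logMap` (+ `logMap_mul`: the "homomorphism of
  groups" clause, proved), `degFunctional`/`deg` (+ `deg_eq`, `deg_mul`), `hyperplane` (+ `logMap_emb_mem`,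
  `hyperplane_ne_top`), (5) `hyperplane_stable`, (6) `periodMap` + `PeriodMapNonconstant` (claim), (7)
  `periodImage` + `PeriodImageAction` (claim; merge-debt T-10 for Thm. 6.3.1's group list).
* Thm. 4.6.1 (4) and Rmk. 4.6.2 (1)–(4) (what the `j²`-scaling of Thm. 4.2.2.1 forces on normalizations and
  hyperplanes; a proved instance of (6)) are the sequel `Joshi/AdelicAnsatzPeriodScaling.lean` (file 3).

## Readings recorded for the faithfulness sheet (located, not adjudicated)
(a) Thm. 4.6.1 is printed for `L`, `V_L`, `arith(L)_{y_j}` while `z ∈ Σ̃_{L′} ⊂ (𝒴′_{L′})^{ℓ⋇}` is indexed by `V_{L′}`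
(p.36 l.24–30); typed over ONE place index `V` (read `L := L′`, as [J-IIh] Rmk. 5.10.2 (2) "one takes `L` to be
`L_mod`"). (b) [J-III] folds the normalization into `|−|_{K_v}` ((2.1.1), p.19 l.9–17); read literally, "the
hyperplane given by the logarithm of (2.1.1)" is `{Σ_v z_v = 0}` for EVERY `y`, against (6) "non-constant"; the
cited proof has `H_y = {z : Σ_v α_v z_v = 0}` with the normalization coordinate `α_y` ([J-IIh] Thm. 5.10.1 (4),
p.38 l.24–41), which is what `hyperplane` types; `logMap` keeps the raw coordinates `log|x_v|_{K_{y_v}}` printed in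
[J-III] (1) and the weights enter through `degFunctional`.

BINDING-POINT RULE (E-PLAN R14): imports no `Cor312*`/`Thm311*` module; binds none of OUR frozen declarations.
Inputs ⊆ Mathlib; no FACT-LIST row consumed; standard axioms only; sorry-free; nothing asserted. Seat
abc-iut-E-t8 (rung LADDER-ABC:A2.E).
-/

noncomputable section

open Set Filter

namespace Summit.ABC.IUTFork.Joshi

/-! ## 2. The carrier of §4.6: arithmeticoids, normalization coordinates -/

/-- CARRIER for [J-III] Thm. 4.6.1 over `AnsatzCurveDatum`: for each place `w` and closed classical point
`y_w ∈ |Y_{C♭_{p_w},L′_w}|`, its RESIDUE FIELD `K_{y_w}` ("an algebraically closed, perfectoid field", [J-III] §4.2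
p.31 l.3–13, §4.4 p.35 l.87–97) with its absolute value `|−|_{K_{y_w}}` (real-valued: [J-IIh] Prop. 4.8.3 (2)
"the value group of `K_{y_v}` is equal to `ℝ`") and the embedding of the number field, `L′ ⊂ L′_w ↪ K_{y_w}` (the
untilt datum `(L_v ↪ K_v, K♭_v ≃ L̂♭_v)` of [J-IIh] Def. 5.1.1, p.29 l.48–58, of which only the embedding is used
in §4.6; the tilt is deliberately NOT typed); `emb_cofinite`: an element of `L′^*` is a unit of `K_{y_w}` for all
but finitely many `w` — what the `L^*`-action on the ideloid of [J-IIh] Lem. 5.4.2 (p.33 l.30–35) presupposes;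
`α y` = the NORMALIZATION COORDINATE `α_y = (α_v)_{v} ∈ ∏_v ℝ_{>0}` of [J-IIh] (5.3.5) (p.32 l.22–44: "real numbers
`α_v` such that `(L_v, |−|_v) = (L_v, |−|^{α_v}_{K_{ξ_v}})` … the normalization coordinate of `y`"); `stdAbs w` =
the standard normalized absolute value `|−|_w` of `L′` ([J-IIh] §5.3 p.32 l.9–16 "the standard choice of
normalizations … [Artin and Whaples, 1945]"). SIGNATURE: no property of these objects is assumed beyond the
types; in particular the product formula is NOT a field (it is the predicate `IsNormalized`, [J-III] (2.1.1)).
The parameter `L` is Joshi's `L′` (reading (a) of the module docstring). [claim: Joshi2024ATS3, status: disputed] -/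
structure ArithPeriodDatum (L : Type) [Field L] extends AnsatzCurveDatum where
  /-- the residue field `K_{y_w}` of `y_w ∈ |Y_{C♭_{p_w},L′_w}|` -/
  K : ∀ w : V, Y w → Type
  /-- `K_{y_w}` is a field -/
  [instField : ∀ (w : V) (y : Y w), Field (K w y)]
  /-- `|−|_{K_{y_w}} : K_{y_w} → ℝ` -/
  abs : ∀ (w : V) (y : Y w), AbsoluteValue (K w y) ℝ
  /-- `L′ ↪ K_{y_w}` -/
  emb : ∀ (w : V) (y : Y w), L →+* K w y
  /-- `x ∈ L′^*` is a `K_{y_w}`-unit for almost all `w` ([J-IIh] Lem. 5.4.2) -/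
  emb_cofinite : ∀ (y : ∀ w, Y w) (x : L), x ≠ 0 → ∀ᶠ w in cofinite, abs w (y w) (emb w (y w) x) = 1
  /-- the normalization coordinate `α_y ∈ ∏_w ℝ_{>0}` ([J-IIh] (5.3.5)) -/
  α : (∀ w, Y w) → V → ℝ
  /-- `α_{y,w} > 0` -/
  α_pos : ∀ y w, 0 < α y w
  /-- the standard absolute value `|−|_w` of `L′` ([J-IIh] (5.3.1)) -/
  stdAbs : V → AbsoluteValue L ℝ

namespace ArithPeriodDatum

variable {L : Type} [Field L] (D : ArithPeriodDatum L)

/-- `K_{y_w}` is a field (signature field re-export, pattern of `Thm311Sig.LogShells`). [folklore] -/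
instance instFieldK (w : D.V) (y : D.Y w) : Field (D.K w y) := D.instField w y

/-- A unit of `K_{y_w}` has positive absolute value. [folklore] -/
theorem abs_unit_pos (w : D.V) (y : D.Y w) (u : (D.K w y)ˣ) : 0 < D.abs w y (u : D.K w y) :=
  (D.abs w y).pos u.ne_zero

/-! ### [J-IIh] Def. 5.4.1 — the ideloid; the diagonal embedding of `L′^*` -/

/-- **[J-IIh] Def. 5.4.1 (p.33 l.19–29), the IDELOID** of the arithmeticoid `arith(L)_y`: "`Ideloid(arith(L)) =
{(x_v)_{v} ∈ ∏_{v ∈ V_L} K_v^* : x_v ∈ O^*_{K_v} for all but finitely many v ∈ V}`"; Lem. 5.4.2: "a topological group"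
(topology NOT typed). Here `x_v ∈ O^*_{K_v}` ⟺ `|x_v|_{K_{y_v}} = 1`. [claim: Joshi2024ATS3, status: disputed] -/
def ideloid (y : D.AdelicPoint) : Subgroup (∀ w : D.V, (D.K w (y w))ˣ) where
  carrier := {x | ∀ᶠ w in cofinite, D.abs w (y w) (x w : D.K w (y w)) = 1}
  one_mem' := by
    simp only [Set.mem_setOf_eq]
    exact Eventually.of_forall fun w => by simp [(D.abs w (y w)).map_one]
  mul_mem' := by
    intro a b ha hb
    simp only [Set.mem_setOf_eq] at ha hb ⊢
    filter_upwards [ha, hb] with w hwa hwb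
    simp [Units.val_mul, (D.abs w (y w)).map_mul, hwa, hwb]
  inv_mem' := by
    intro a ha
    simp only [Set.mem_setOf_eq] at ha ⊢
    filter_upwards [ha] with w hw
    simp [Units.val_inv_eq_inv_val, map_inv₀, hw]

/-- Membership in the ideloid: `|x_w|_{K_{y_w}} = 1` for all but finitely many `w`. [folklore] -/
theorem mem_ideloid_iff (y : D.AdelicPoint) (x : ∀ w : D.V, (D.K w (y w))ˣ) :
    x ∈ D.ideloid y ↔ ∀ᶠ w in cofinite, D.abs w (y w) (x w : D.K w (y w)) = 1 := Iff.rfl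

/-- The diagonal image of `x ∈ L′^*` in `∏_w K_{y_w}^*` ([J-IIh] Lem. 5.1.3, p.30 l.26–45: "`L ↪ R = ∏_v K_v` given by
`x ↦ (x)_v`"). [claim: Joshi2024ATS3, status: disputed] -/
def embUnits (y : D.AdelicPoint) (x : Lˣ) : ∀ w : D.V, (D.K w (y w))ˣ :=
  fun w => Units.map (D.emb w (y w) : L →* D.K w (y w)) x

/-- Coordinates of the diagonal image. [folklore] -/
@[simp] theorem embUnits_apply (y : D.AdelicPoint) (x : Lˣ) (w : D.V) :
    (D.embUnits y x w : D.K w (y w)) = D.emb w (y w) (x : L) := rfl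

/-- The diagonal image of `L′^*` lies in the ideloid (by `emb_cofinite`). [folklore] -/
theorem embUnits_mem (y : D.AdelicPoint) (x : Lˣ) : D.embUnits y x ∈ D.ideloid y := by
  rw [mem_ideloid_iff]
  simpa using D.emb_cofinite y (x : L) x.ne_zero

/-- **[J-IIh] Lem. 5.4.2 (p.33 l.30–35)**: "The ideloid … is equipped with a natural multiplicative action of `L^*`
… `(x, (z_v)_v) ↦ (x · z_v)_v`" — the diagonal embedding `ι_y : L′^* → Ideloid(arith(L′)_y)` through which `L′^*`
acts by multiplication. [claim: Joshi2024ATS3, status: disputed] -/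
def embIdeloid (y : D.AdelicPoint) (x : Lˣ) : D.ideloid y := ⟨D.embUnits y x, D.embUnits_mem y x⟩

/-- `ι_y` is multiplicative. [folklore] -/
theorem embIdeloid_mul (y : D.AdelicPoint) (x x' : Lˣ) :
    D.embIdeloid y (x * x') = D.embIdeloid y x * D.embIdeloid y x' := by
  apply Subtype.ext; funext w; simp [embIdeloid, embUnits]

/-! ### Thm. 4.6.1 (1): the logarithm map of an ideloid -/

/-- **[J-III] Thm. 4.6.1 (1) (p.36 l.26–41) = [J-IIh] Thm. 5.10.1 (1)**: "Consider the `ℝ`-vector space `V_{L,j} =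
⊕_{v ∈ V_L} ℝ_{v,j}` … the ideloid `Ideloid(arith(L)_{y_j})` provides a homomorphism of groups `log_{arith(L)_{y_j}} :
Ideloid(arith(L)_{y_j}) → V_{L,j}` given by `(x_v)_{v ∈ V_L} ↦ (log |x_v|_{K_{y_v}})_{v ∈ V_L}`." `V_{L,j}` is typed as the
finitely supported functions `V →₀ ℝ` (the direct sum); the value is finitely supported BY the ideloid condition.
Coordinates are the raw logarithms `log |x_v|_{K_{y_v}}` as printed in [J-III] (reading (b) of the module
docstring: [J-IIh] (1) prints `log |x_v|^{α_v}`; the `α`-weights enter in `degFunctional`).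
[claim: Joshi2024ATS3, status: disputed] -/
def logMap (y : D.AdelicPoint) (x : D.ideloid y) : D.V →₀ ℝ :=
  Finsupp.ofSupportFinite (fun w => Real.log (D.abs w (y w) ((x : ∀ w, (D.K w (y w))ˣ) w : D.K w (y w))))
    (by
      refine (eventually_cofinite.1 x.2).subset ?_
      intro w hw h
      exact hw (by simp only [h, Real.log_one]))

/-- Coordinates of `log_y`. [folklore] -/
@[simp] theorem logMap_apply (y : D.AdelicPoint) (x : D.ideloid y) (w : D.V) :
    D.logMap y x w = Real.log (D.abs w (y w) ((x : ∀ w, (D.K w (y w))ˣ) w : D.K w (y w))) := rfl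

/-- **Thm. 4.6.1 (1), "homomorphism of groups" — PROVED** over the signature: `log_y (x x′) = log_y x + log_y x′`
(multiplicativity of `|−|_{K_{y_w}}` and of `log` on positive reals). [folklore] -/
theorem logMap_mul (y : D.AdelicPoint) (x x' : D.ideloid y) :
    D.logMap y (x * x') = D.logMap y x + D.logMap y x' := by
  ext w
  simp only [logMap_apply, Subgroup.coe_mul, Pi.mul_apply, Units.val_mul, (D.abs _ _).map_mul,
    Finsupp.coe_add, Pi.add_apply]
  exact Real.log_mul (D.abs_unit_pos _ _ _).ne' (D.abs_unit_pos _ _ _).ne'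

/-- `log_y 1 = 0`. [folklore] -/
theorem logMap_one (y : D.AdelicPoint) : D.logMap y 1 = 0 := by
  ext w; simp [(D.abs _ _).map_one]

/-! ### Thm. 4.6.1 (2): the normalized arithmetic degree -/

/-- The `α_y`-weighted sum functional `V_L → ℝ`, `(z_v)_v ↦ Σ_v α_{y,v} z_v` ([J-IIh] Thm. 5.10.1 (4), p.38 l.24–41:
"`H_y = {z = (z_v) ∈ ⊕_v ℝ : Σ_{v} α_v · z_v = 0}` [the sum is well-defined because any `z` has all but finitely
many coordinates `z_v = 0`]"). [claim: Joshi2024ATS3, status: disputed] -/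
def degFunctional (y : D.AdelicPoint) : (D.V →₀ ℝ) →ₗ[ℝ] ℝ :=
  Finsupp.linearCombination ℝ (D.α y)

/-- The functional evaluated: `Σ_w z_w · α_{y,w}`. [folklore] -/
theorem degFunctional_apply (y : D.AdelicPoint) (l : D.V →₀ ℝ) :
    D.degFunctional y l = l.sum (fun w r => r * D.α y w) := by
  simp [degFunctional, Finsupp.linearCombination_apply, smul_eq_mul]

/-- On a coordinate vector: `degFunctional (single w r) = r · α_{y,w}`. [folklore] -/
@[simp] theorem degFunctional_single (y : D.AdelicPoint) (w : D.V) (r : ℝ) :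
    D.degFunctional y (Finsupp.single w r) = r * D.α y w := by
  simp [degFunctional, smul_eq_mul]

/-- **[J-IIh] Def. 5.4.3 (p.33 l.37–48), the NORMALIZED ARITHMETIC DEGREE** `deg_y : Ideloid(arith(L)) → ℝ`,
"`deg_y((x_v)_v) = Σ_{v} log |x_v|^{α_v}_{K_v}`. This is a finite sum by the definition of an ideloid"; = [J-III]
Thm. 4.6.1 (2) "`(x_v) ↦ (log|x_v|_{K_{y_v}})_v ↦ Σ_v log(|x_v|_{K_{y_v}}) = deg_{y_j}((x_v)_v)`".
[claim: Joshi2024ATS3, status: disputed] -/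
def deg (y : D.AdelicPoint) (x : D.ideloid y) : ℝ := D.degFunctional y (D.logMap y x)

/-- **Thm. 4.6.1 (2) — PROVED**: the degree is the composite `Ideloid → V_L → ℝ` of `log_y` with the (weighted) sum,
`deg_y x = Σ_w α_{y,w} · log |x_w|_{K_{y_w}}`. [folklore] -/
theorem deg_eq (y : D.AdelicPoint) (x : D.ideloid y) :
    D.deg y x = (D.logMap y x).sum (fun w r => r * D.α y w) := D.degFunctional_apply y _

/-- **Thm. 4.6.1 (2), "degree homomorphism" — PROVED**: `deg_y (x x′) = deg_y x + deg_y x′`. [folklore] -/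
theorem deg_mul (y : D.AdelicPoint) (x x' : D.ideloid y) : D.deg y (x * x') = D.deg y x + D.deg y x' := by
  simp only [deg, logMap_mul, map_add]

/-! ### [J-IIh] §5.3 / [J-III] (2.1.1): normalized arithmeticoids -/

/-- **NORMALIZED ARITHMETICOID, [J-IIh] (5.3.4) = [J-III] (2.1.1)** (p.19 l.9–17: "I will also assume throughout
this paper that all arithmeticoids `arith(L)_y` are normalized i.e. … the Artin–Whaples product formula holds for
each `x ∈ L^*`: `∏_{v ∈ V_L} |x|_{K_v} = 1`"; [J-IIh] p.32 l.29–44: "the product formula reads `∏_v |x|^{α_v}_{K_{ξ_v}} = 1`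
… I will write this as `arith(L)^nor_y`"): in logarithms, `deg_y (ι_y x) = Σ_w α_{y,w} log|x|_{K_{y_w}} = 0` for all
`x ∈ L′^*`. A PREDICATE on `y` (Joshi's standing assumption), never asserted. [claim: Joshi2024ATS3, status: disputed] -/
def IsNormalized (y : D.AdelicPoint) : Prop := ∀ x : Lˣ, D.deg y (D.embIdeloid y x) = 0

/-- **[J-IIh] (5.3.3) (p.32 l.22–28)**: "there exist, for each `v ∈ V_L`, real numbers `α_v ∈ ℝ` such that `(L_v, |−|_v)
= (L_v, |−|^{α_v}_{K_{ξ_v}})`" — the normalization coordinate `α_y` recovers the STANDARD absolute values on `L′`.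
Predicate, never asserted. [claim: Joshi2024ATS3, status: disputed] -/
def IsStdNormalized (y : D.AdelicPoint) : Prop :=
  ∀ (w : D.V) (x : L), (D.abs w (y w) (D.emb w (y w) x)) ^ (D.α y w) = D.stdAbs w x

/-- **[J-IIh] Lem. 5.4.4 (p.33 l.49–53) — PROVED** from `IsNormalized`: "for all `x ∈ L^*` and all `(z_v) ∈ Ideloid`
one has `deg_y (x · (z_v)_v) = deg_y ((z_v)_v)`". [folklore] -/
theorem deg_emb_mul {y : D.AdelicPoint} (hy : D.IsNormalized y) (x : Lˣ) (z : D.ideloid y) :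
    D.deg y (D.embIdeloid y x * z) = D.deg y z := by
  rw [deg_mul, hy x, zero_add]

/-! ### Thm. 4.6.1 (3), (5): the product-formula hyperplane -/

/-- **[J-III] Thm. 4.6.1 (3) (p.37 l.9–18) = [J-IIh] Thm. 5.10.1 (3)–(4)**: "each normalized `arith(L)^nor_y` provides
a hyperplane `H_{y_j} ⊂ V_{L,j}` given by the logarithm of product formula equation (2.1.1) … `H_{y_j} : deg_{y_j}((x)_v)
= Σ_v log|x|_{K_{y_j,v}} = 0` (for all `x ∈ L^*`)"; [J-IIh] (4): "Explicitly … `H_y = {z = (z_v) ∈ ⊕_v ℝ : Σ_v α_v ·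
z_v = 0}`". Typed in the explicit form (4): the kernel of `degFunctional y` (reading (b): with `α` folded into the
absolute values the literal hyperplane `{Σ_v z_v = 0}` would not depend on `y`). [claim: Joshi2024ATS3, status: disputed] -/
def hyperplane (y : D.AdelicPoint) : Submodule ℝ (D.V →₀ ℝ) := LinearMap.ker (D.degFunctional y)

/-- Membership in `H_y`: `Σ_w z_w α_{y,w} = 0`. [folklore] -/
theorem mem_hyperplane_iff (y : D.AdelicPoint) (l : D.V →₀ ℝ) :
    l ∈ D.hyperplane y ↔ l.sum (fun w r => r * D.α y w) = 0 := by
  rw [hyperplane, LinearMap.mem_ker, degFunctional_apply]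

/-- **Thm. 4.6.1 (3), "given by the product formula" — PROVED** from `IsNormalized`: `log_y(ι_y x) ∈ H_y` for every
`x ∈ L′^*` ([J-IIh] (3): "`H_y : log_y(L^*) = 0`"). [folklore] -/
theorem logMap_emb_mem {y : D.AdelicPoint} (hy : D.IsNormalized y) (x : Lˣ) :
    D.logMap y (D.embIdeloid y x) ∈ D.hyperplane y := by
  rw [hyperplane, LinearMap.mem_ker]; exact hy x

/-- `H_y` is a PROPER subspace ("hyperplane") as soon as `V_{L′} ≠ ∅` — PROVED (`α_{y,w} > 0`). [folklore] -/
theorem hyperplane_ne_top (y : D.AdelicPoint) (w : D.V) : D.hyperplane y ≠ ⊤ := by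
  intro h
  have hmem : Finsupp.single w (1 : ℝ) ∈ D.hyperplane y := by rw [h]; exact Submodule.mem_top
  rw [hyperplane, LinearMap.mem_ker, degFunctional_single, one_mul] at hmem
  exact (D.α_pos y w).ne' hmem

/-- `H_y` depends on `α_y` only up to a common positive scalar (the target of the period map is the PROJECTIVE
space of hyperplanes, Thm. 4.6.1 (6)) — PROVED. [folklore] -/
theorem mem_hyperplane_iff_of_alpha_eq_smul {y y' : D.AdelicPoint} {c : ℝ} (hc : c ≠ 0)
    (h : ∀ w, D.α y' w = c * D.α y w) (l : D.V →₀ ℝ) : l ∈ D.hyperplane y' ↔ l ∈ D.hyperplane y := by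
  simp only [mem_hyperplane_iff, h]
  have : (l.sum fun w r => r * (c * D.α y w)) = c * l.sum fun w r => r * D.α y w := by
    rw [Finsupp.mul_sum]; exact Finsupp.sum_congr fun w _ => by ring
  rw [this, mul_eq_zero, or_iff_right hc]

/-- **[J-III] Thm. 4.6.1 (5) (p.37 l.27–29) = [J-IIh] Thm. 5.10.1 (5) — PROVED** from `IsNormalized`: "As the product
formula (2.1.1) holds for each normalized arithmeticoid `arith(L)^nor_{y_j}`, the hyperplane `H_{y_j}` is stable under
multiplication by elements of `L^*`" (the `L^*`-action of Lem. 5.4.2 read through `log_y`: translation by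
`log_y(ι_y x)`). [folklore] -/
theorem hyperplane_stable {y : D.AdelicPoint} (hy : D.IsNormalized y) (x : Lˣ) {l : D.V →₀ ℝ}
    (hl : l ∈ D.hyperplane y) : D.logMap y (D.embIdeloid y x) + l ∈ D.hyperplane y :=
  Submodule.add_mem _ (D.logMap_emb_mem hy x) hl

/-- (5) at the level of the ideloid: `log_y (ι_y x · z) ∈ H_y ↔ log_y z ∈ H_y` — PROVED. [folklore] -/
theorem logMap_emb_mul_mem_iff {y : D.AdelicPoint} (hy : D.IsNormalized y) (x : Lˣ) (z : D.ideloid y) :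
    D.logMap y (D.embIdeloid y x * z) ∈ D.hyperplane y ↔ D.logMap y z ∈ D.hyperplane y := by
  rw [logMap_mul]
  refine ⟨fun h => ?_, D.hyperplane_stable hy x⟩
  have := Submodule.sub_mem _ h (D.logMap_emb_mem hy x)
  simpa using this

/-! ### Thm. 4.6.1 (6), (7): the period mapping on the Ansatz -/

/-- **[J-III] Thm. 4.6.1 (6) (p.37 l.30–39) = [J-IIh] Thm. 5.10.1 (7)**: "Let `ℙ(V_L)` be the projective space of
hyperplanes in `V_L`. Then one has a natural and non-constant function defined on Mochizuki's Adelic Ansatz (§4.2):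
`𝒴^{ℓ⋇}_{L′} ⊇ Σ̃_{L′} → ∏_{j=1}^{ℓ⋇} ℙ(V_{L,j})` given by `Σ̃_{L′} ∋ z = (y_1, …, y_{ℓ⋇}) ↦ (H_{y_1}, …, H_{y_{ℓ⋇}})`" ([J-IIh]:
"called the period mapping of the Arithmetic Teichmüller Theory of the number field"). Typed on all tuples with
values in `ℓ⋇`-tuples of subspaces (each a proper hyperplane by `hyperplane_ne_top`). [claim: Joshi2024ATS3, status: disputed] -/
def periodMap (z : D.Tuple) : Fin D.lstar → Submodule ℝ (D.V →₀ ℝ) := fun i => D.hyperplane (z i)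

/-- **Thm. 4.6.1 (6), "non-constant"** (proof, [J-IIh] p.38 l.57–62: "immediate from the fact that normalizations of
arithmeticoids do not carry over because locally at each prime `v ∈ V^non_L`, valuations cannot be simultaneously
normalized on `Y_{C♭_p,ℚ_p}`"). HYPOTHESIS, never asserted (a proved instance along ONE Ansatz point is
`hyperplane_first_ne`). E6-type attach point, located not adjudicated: [J-III] p.36 l.21–23 "This relationship
… is an important, but undemonstrated point in [IUTchIII], and the absence of proof … led to the denial of its
existence in [Scholze and Stix, 2018, Section 2.2]". [claim: Joshi2024ATS3, status: disputed] -/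
@[claim "Joshi2024ATS3" "disputed"]
def PeriodMapNonconstant : Prop :=
  ∃ z ∈ D.ansatz, ∃ z' ∈ D.ansatz, D.periodMap z ≠ D.periodMap z'

/-- **[J-III] Thm. 4.6.1 (7) (p.37 l.40–43), the image** "`ℙ(Σ̃_{L′}) ⊂ ∏_{j=1}^{ℓ⋇} ℙ(V_{L,j})` … the image of `Σ̃_{L′}` under
this function". [claim: Joshi2024ATS3, status: disputed] -/
def periodImage : Set (Fin D.lstar → Submodule ℝ (D.V →₀ ℝ)) := D.periodMap '' D.ansatz

/-- **Thm. 4.6.1 (7), the action clause**: "`ℙ(Σ̃_{L′})` is equipped with a natural action of all the groups and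
symmetries given by Theorem 6.3.1 which act upon `Σ̃_{L′}`" (= [J-IIh] Thm. 5.10.1 (8); the groups: `G_{L′}`, the
global Frobenius `φ`, `L′^*` of Thm. 4.2.2.1 (1)–(3) — slot T-07 —, and those of [J-III] Thm. 6.3.1 — slot T-10,
merge-debt). Typed over an ABSTRACT action `act` on tuples: it preserves `Σ̃_{L′}` and DESCENDS to the image
(equal period tuples have equal period tuples after acting), which is what "equipped with a natural [induced]
action" requires. HYPOTHESIS, never asserted. [claim: Joshi2024ATS3, status: disputed] -/
@[claim "Joshi2024ATS3" "disputed"]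
def PeriodImageAction {G : Type} (act : G → D.Tuple → D.Tuple) : Prop :=
  (∀ g : G, ∀ z ∈ D.ansatz, act g z ∈ D.ansatz) ∧
    ∀ g : G, ∀ z ∈ D.ansatz, ∀ z' ∈ D.ansatz,
      D.periodMap z = D.periodMap z' → D.periodMap (act g z) = D.periodMap (act g z')

end ArithPeriodDatum

end Summit.ABC.IUTFork.Joshi
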